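import Mathlib.Geometry.Manifold.LocalDiffeomorph
import Mathlib.Geometry.Manifold.ContMDiffMFDeriv
import Mathlib.Geometry.Manifold.Instances.Real
import HarnessLib

/-!
# Flat leaves for `GromovRecognitionRelEnd` — the smooth inverse of an injective local
diffeomorphism on an open set (stub `stub_flatLeaves` of line `cross-cap-laurent`, crux
`SymplecticOrigami.GromovRecognitionRelEnd`, item stmt-SmoothPoincare4-11009; first auxiliary file)

The cap charts `ηH`, `ηV`, `ηC : ℝ⁴ → X` of the wedge cap are only LOCAL diffeomorphisms on an
open coordinate domain `D ⊆ ℝ⁴`, injective on `D` (Mathlib `IsLocalDiffeomorphOn` + `Set.InjOn`).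
This generic file packages what the flat-leaf argument needs from such a map `η : P → X`
between manifolds:

* `Function.invFunOn η D : X → P` is a two-sided inverse on `D` / `η '' D`
  (`invFunOn_apply_of_mem`, `apply_invFunOn_of_mem`);
* the image `η '' D` is a neighbourhood of each of its points (`image_mem_nhds`, `isOpen_image`)
  and `invFunOn η D` agrees near `η p` with Mathlib's chosen local inverse, hence is `C^∞` there
  (`contMDiffAt_invFunOn`; Lee 2013, Prop. 4.22 / Thm. 4.14 pattern);
* the two differential identities `d(η⁻¹) ∘ dη = id`, `dη ∘ d(η⁻¹) = id` in applied form and the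
  injectivity of `d(η⁻¹)` (`mfderiv_invFunOn_apply_mfderiv`, `mfderiv_apply_mfderiv_invFunOn`,
  `mfderiv_invFunOn_eq_zero`);
* **holomorphicity transfers to the inverse** (`mfderiv_invFunOn_map`): if
  `J_X ∘ dη = dη ∘ J_P` on `D` for two fields of tangent-space endomorphisms, then
  `d(η⁻¹) ∘ J_X = J_P ∘ d(η⁻¹)` on `η '' D`.

Everything is proved; no definition, no named fact.

References: J. M. Lee, *Introduction to Smooth Manifolds*, 2nd ed. (2013), Thm. 4.14,
Prop. 4.22 [LeeSmoothManifolds2013].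
-/

noncomputable section

-- the registered namespace `Summit.SmoothPoincare4.SmoothPoincare4.Theorems…` repeats a component
set_option linter.dupNamespace false

open scoped Manifold ContDiff Topology
open Set Function Filter

namespace Summit.SmoothPoincare4.SmoothPoincare4.Theorems.GromovRecognitionRelEnd.CrossCapLaurent

namespace FlatLeaves

variable {E : Type*} [NormedAddCommGroup E] [NormedSpace ℝ E] {H : Type*} [TopologicalSpace H]
  {I : ModelWithCorners ℝ E H} {P : Type*} [TopologicalSpace P] [ChartedSpace H P] [Nonempty P]
  {E' : Type*} [NormedAddCommGroup E'] [NormedSpace ℝ E'] {H' : Type*} [TopologicalSpace H']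
  {I' : ModelWithCorners ℝ E' H'} {X : Type*} [TopologicalSpace X] [ChartedSpace H' X]
  {η : P → X} {D : Set P}

/-! ## The inverse on the image -/

omit [TopologicalSpace P] [ChartedSpace H P] [TopologicalSpace X] [ChartedSpace H' X] in
/-- `η⁻¹ (η p) = p` for `p ∈ D` (`η` injective on `D`). [folklore] -/
theorem invFunOn_apply_of_mem (hinj : InjOn η D) {p : P} (hp : p ∈ D) :
    invFunOn η D (η p) = p :=
  hinj.leftInvOn_invFunOn hp

omit [TopologicalSpace P] [ChartedSpace H P] [TopologicalSpace X] [ChartedSpace H' X] in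
/-- `η (η⁻¹ y) = y` on the image `η '' D`. [folklore] -/
theorem apply_invFunOn_of_mem {y : X} (hy : y ∈ η '' D) : η (invFunOn η D y) = y :=
  invFunOn_eq hy

omit [TopologicalSpace P] [ChartedSpace H P] [TopologicalSpace X] [ChartedSpace H' X] in
/-- `η⁻¹ y ∈ D` on the image `η '' D`. [folklore] -/
theorem invFunOn_mem_of_mem {y : X} (hy : y ∈ η '' D) : invFunOn η D y ∈ D :=
  invFunOn_mem hy

/-- **Local structure of the inverse.** Near `η p`, `p ∈ D` (`D` open, `η` an injective local
diffeomorphism on `D`), every point lies in `η '' D` and `η⁻¹ := invFunOn η D` coincides with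
Mathlib's chosen local inverse of `η` at `p`. [cite: LeeSmoothManifolds2013, Thm. 4.14] -/
theorem eventually_mem_image_and_invFunOn_eq {n : WithTop ℕ∞} (hD : IsOpen D)
    (hη : IsLocalDiffeomorphOn I I' n η D) (hinj : InjOn η D) {p : P} (hp : p ∈ D) :
    ∀ᶠ y in 𝓝 (η p), y ∈ η '' D ∧ invFunOn η D y = (hη ⟨p, hp⟩).localInverse y := by
  have hf : IsLocalDiffeomorphAt I I' n η p := hη ⟨p, hp⟩
  have h1 : hf.localInverse.source ∈ 𝓝 (η p) :=
    hf.localInverse.open_source.mem_nhds hf.localInverse_mem_source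
  have hΦp : hf.localInverse (η p) = p := hf.localInverse_left_inv hf.localInverse_mem_target
  have h2 : ∀ᶠ y in 𝓝 (η p), hf.localInverse y ∈ D := by
    apply hf.localInverse_contMDiffAt.continuousAt.preimage_mem_nhds
    rw [hΦp]
    exact hD.mem_nhds hp
  filter_upwards [h1, h2] with y hy1 hy2
  have hy : η (hf.localInverse y) = y := hf.localInverse_right_inv hy1
  refine ⟨⟨_, hy2, hy⟩, ?_⟩
  calc invFunOn η D y = invFunOn η D (η (hf.localInverse y)) := by rw [hy]
    _ = hf.localInverse y := hinj.leftInvOn_invFunOn hy2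

/-- **The image of `D` is a neighbourhood of `η p`**, `p ∈ D`. [cite: LeeSmoothManifolds2013, Prop. 4.22] -/
theorem image_mem_nhds {n : WithTop ℕ∞} (hD : IsOpen D) (hη : IsLocalDiffeomorphOn I I' n η D)
    (hinj : InjOn η D) {p : P} (hp : p ∈ D) : η '' D ∈ 𝓝 (η p) :=
  (eventually_mem_image_and_invFunOn_eq hD hη hinj hp).mono fun _ hy => hy.1

/-- **The image of the open coordinate domain is open.** [cite: LeeSmoothManifolds2013, Prop. 4.22] -/
theorem isOpen_image {n : WithTop ℕ∞} (hD : IsOpen D) (hη : IsLocalDiffeomorphOn I I' n η D)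
    (hinj : InjOn η D) : IsOpen (η '' D) := by
  refine isOpen_iff_mem_nhds.2 ?_
  rintro y ⟨p, hp, rfl⟩
  exact image_mem_nhds hD hη hinj hp

/-- **The inverse is `C^n` at the points of the image.** [cite: LeeSmoothManifolds2013, Thm. 4.14] -/
theorem contMDiffAt_invFunOn {n : WithTop ℕ∞} (hD : IsOpen D)
    (hη : IsLocalDiffeomorphOn I I' n η D) (hinj : InjOn η D) {p : P} (hp : p ∈ D) :
    ContMDiffAt I' I n (invFunOn η D) (η p) :=
  (hη ⟨p, hp⟩).localInverse_contMDiffAt.congr_of_eventuallyEq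
    ((eventually_mem_image_and_invFunOn_eq hD hη hinj hp).mono fun _ hy => hy.2)

/-- The inverse is `C^n` at `y ∈ η '' D`. [folklore] -/
theorem contMDiffAt_invFunOn_of_mem {n : WithTop ℕ∞} (hD : IsOpen D)
    (hη : IsLocalDiffeomorphOn I I' n η D) (hinj : InjOn η D) {y : X} (hy : y ∈ η '' D) :
    ContMDiffAt I' I n (invFunOn η D) y := by
  obtain ⟨p, hp, rfl⟩ := hy
  exact contMDiffAt_invFunOn hD hη hinj hp

omit [Nonempty P] in
/-- `η` is `C^n` at the points of `D`. [folklore] -/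
theorem contMDiffAt_of_mem {n : WithTop ℕ∞} (hη : IsLocalDiffeomorphOn I I' n η D) {p : P}
    (hp : p ∈ D) : ContMDiffAt I I' n η p :=
  (hη ⟨p, hp⟩).contMDiffAt

/-! ## The differentials of `η` and `η⁻¹` are inverse to each other -/

/-- **`d(η⁻¹)_{η p} ∘ dη_p = id`** for `p ∈ D`. [folklore] -/
theorem mfderiv_invFunOn_comp_mfderiv (hD : IsOpen D) (hη : IsLocalDiffeomorphOn I I' ∞ η D)
    (hinj : InjOn η D) {p : P} (hp : p ∈ D) :
    (mfderiv I' I (invFunOn η D) (η p)).comp (mfderiv I I' η p) =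
      ContinuousLinearMap.id ℝ (TangentSpace I p) := by
  have h1 : MDifferentiableAt I I' η p := (hη ⟨p, hp⟩).mdifferentiableAt (by simp)
  have h2 : MDifferentiableAt I' I (invFunOn η D) (η p) :=
    (contMDiffAt_invFunOn hD hη hinj hp).mdifferentiableAt (by simp)
  have hev : (invFunOn η D ∘ η) =ᶠ[𝓝 p] id := by
    filter_upwards [hD.mem_nhds hp] with p' hp'
    exact hinj.leftInvOn_invFunOn hp'
  rw [← mfderiv_comp p h2 h1, hev.mfderiv_eq, mfderiv_id]

/-- `d(η⁻¹)_{η p} (dη_p v) = v` for `p ∈ D`. [folklore] -/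
theorem mfderiv_invFunOn_apply_mfderiv (hD : IsOpen D) (hη : IsLocalDiffeomorphOn I I' ∞ η D)
    (hinj : InjOn η D) {p : P} (hp : p ∈ D) (v : TangentSpace I p) :
    mfderiv I' I (invFunOn η D) (η p) (mfderiv I I' η p v) = v := by
  have h := mfderiv_invFunOn_comp_mfderiv hD hη hinj hp
  exact congrArg (fun L : TangentSpace I p →L[ℝ] TangentSpace I p => L v) h

/-- **`dη ∘ d(η⁻¹)_y = id`** at the points `y` of the image. [folklore] -/
theorem mfderiv_comp_mfderiv_invFunOn (hD : IsOpen D) (hη : IsLocalDiffeomorphOn I I' ∞ η D)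
    (hinj : InjOn η D) {y : X} (hy : y ∈ η '' D) :
    (mfderiv I I' η (invFunOn η D y)).comp (mfderiv I' I (invFunOn η D) y) =
      ContinuousLinearMap.id ℝ (TangentSpace I' y) := by
  have h1 : MDifferentiableAt I I' η (invFunOn η D y) :=
    (contMDiffAt_of_mem hη (invFunOn_mem_of_mem hy)).mdifferentiableAt (by simp)
  have h2 : MDifferentiableAt I' I (invFunOn η D) y :=
    (contMDiffAt_invFunOn_of_mem hD hη hinj hy).mdifferentiableAt (by simp)
  have hev : (η ∘ invFunOn η D) =ᶠ[𝓝 y] id := by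
    have hy' : η '' D ∈ 𝓝 y := by
      obtain ⟨p, hp, rfl⟩ := hy
      exact image_mem_nhds hD hη hinj hp
    filter_upwards [hy'] with y' hy'
    exact invFunOn_eq hy'
  rw [← mfderiv_comp y h1 h2, hev.mfderiv_eq, mfderiv_id]

/-- `dη (d(η⁻¹)_y w) = w` on the image. [folklore] -/
theorem mfderiv_apply_mfderiv_invFunOn (hD : IsOpen D) (hη : IsLocalDiffeomorphOn I I' ∞ η D)
    (hinj : InjOn η D) {y : X} (hy : y ∈ η '' D) (w : TangentSpace I' y) :
    mfderiv I I' η (invFunOn η D y) (mfderiv I' I (invFunOn η D) y w) = w := by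
  have h := mfderiv_comp_mfderiv_invFunOn hD hη hinj hy
  exact congrArg (fun L : TangentSpace I' y →L[ℝ] TangentSpace I' y => L w) h

/-- `dη_p (d(η⁻¹)_{η p} w) = w` for `p ∈ D`. [folklore] -/
theorem mfderiv_apply_mfderiv_invFunOn' (hD : IsOpen D) (hη : IsLocalDiffeomorphOn I I' ∞ η D)
    (hinj : InjOn η D) {p : P} (hp : p ∈ D) (w : TangentSpace I' (η p)) :
    mfderiv I I' η p (mfderiv I' I (invFunOn η D) (η p) w) = w := by
  have h := mfderiv_apply_mfderiv_invFunOn hD hη hinj (mem_image_of_mem η hp) w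
  rwa [invFunOn_apply_of_mem hinj hp] at h

/-- **`d(η⁻¹)_y` is injective** on the image. [folklore] -/
theorem mfderiv_invFunOn_eq_zero (hD : IsOpen D) (hη : IsLocalDiffeomorphOn I I' ∞ η D)
    (hinj : InjOn η D) {y : X} (hy : y ∈ η '' D) {w : TangentSpace I' y}
    (hw : mfderiv I' I (invFunOn η D) y w = 0) : w = 0 := by
  have h := mfderiv_apply_mfderiv_invFunOn hD hη hinj hy w
  rw [hw, map_zero] at h
  exact h.symm

/-- `dη_p` is injective for `p ∈ D`. [folklore] -/
theorem mfderiv_eq_zero (hD : IsOpen D) (hη : IsLocalDiffeomorphOn I I' ∞ η D)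
    (hinj : InjOn η D) {p : P} (hp : p ∈ D) {v : TangentSpace I p}
    (hv : mfderiv I I' η p v = 0) : v = 0 := by
  have h := mfderiv_invFunOn_apply_mfderiv hD hη hinj hp v
  rw [hv, map_zero] at h
  exact h.symm

/-! ## Holomorphicity of the inverse -/

/-- **The inverse of a holomorphic chart is holomorphic.** If `J_X (dη q) = dη (J_P q)` on `D`
for two fields of tangent-space endomorphisms `J_P`, `J_X`, then
`d(η⁻¹) (J_X w) = J_P (d(η⁻¹) w)` at `η p`, `p ∈ D`. [folklore] -/
theorem mfderiv_invFunOn_map (hD : IsOpen D) (hη : IsLocalDiffeomorphOn I I' ∞ η D)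
    (hinj : InjOn η D) {JP : ∀ p : P, TangentSpace I p →L[ℝ] TangentSpace I p}
    {JX : ∀ y : X, TangentSpace I' y →L[ℝ] TangentSpace I' y}
    (hhol : ∀ p ∈ D, ∀ q : TangentSpace I p,
      JX (η p) (mfderiv I I' η p q) = mfderiv I I' η p (JP p q))
    {p : P} (hp : p ∈ D) (w : TangentSpace I' (η p)) :
    mfderiv I' I (invFunOn η D) (η p) (JX (η p) w) =
      JP p (mfderiv I' I (invFunOn η D) (η p) w) := by
  set q := mfderiv I' I (invFunOn η D) (η p) w with hq
  have hw : mfderiv I I' η p q = w := mfderiv_apply_mfderiv_invFunOn' hD hη hinj hp w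
  rw [← hw, hhol p hp q, mfderiv_invFunOn_apply_mfderiv hD hη hinj hp]

/-- The same at a point `y` of the image, with `p = η⁻¹ y`. [folklore] -/
theorem mfderiv_invFunOn_map_of_mem (hD : IsOpen D) (hη : IsLocalDiffeomorphOn I I' ∞ η D)
    (hinj : InjOn η D) {JP : ∀ p : P, TangentSpace I p →L[ℝ] TangentSpace I p}
    {JX : ∀ y : X, TangentSpace I' y →L[ℝ] TangentSpace I' y}
    (hhol : ∀ p ∈ D, ∀ q : TangentSpace I p,
      JX (η p) (mfderiv I I' η p q) = mfderiv I I' η p (JP p q))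
    {y : X} (hy : y ∈ η '' D) (w : TangentSpace I' y) :
    mfderiv I' I (invFunOn η D) y (JX y w) =
      JP (invFunOn η D y) (mfderiv I' I (invFunOn η D) y w) := by
  obtain ⟨p, hp, rfl⟩ := hy
  have h := mfderiv_invFunOn_map hD hη hinj hhol hp w
  -- rewrite the base point `p = η⁻¹ (η p)` on the right
  have hp' : invFunOn η D (η p) = p := invFunOn_apply_of_mem hinj hp
  rw [h]
  exact (congrArg (fun r : P => (JP r : E →L[ℝ] E) (mfderiv I' I (invFunOn η D) (η p) w)) hp').symm

end FlatLeaves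

/-- **Registered helper sub-goal `helper_flatLeavesChartInverse`** (first auxiliary file of stub
`stub_flatLeaves`): an injective `C^∞` local diffeomorphism `η` on an open set `D ⊆ ℝ⁴` of a
`4`-manifold has open image `η '' D`, and its inverse `Function.invFunOn η D` is `C^∞` at every
point of the image. [cite: LeeSmoothManifolds2013, Prop. 4.22] -/
theorem helper_flatLeavesChartInverse : ∀ (X : Type) [TopologicalSpace X]
    [ChartedSpace (EuclideanSpace ℝ (Fin 4)) X] (η : EuclideanSpace ℝ (Fin 4) → X)
    (D : Set (EuclideanSpace ℝ (Fin 4))), IsOpen D →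
    IsLocalDiffeomorphOn 𝓘(ℝ, EuclideanSpace ℝ (Fin 4)) (𝓡 4) ∞ η D → Set.InjOn η D →
    IsOpen (η '' D) ∧ ∀ p ∈ D,
      ContMDiffAt (𝓡 4) 𝓘(ℝ, EuclideanSpace ℝ (Fin 4)) ∞ (Function.invFunOn η D) (η p) :=
  fun _ _ _ _ _ hD hη hinj =>
    ⟨FlatLeaves.isOpen_image hD hη hinj, fun _ hp => FlatLeaves.contMDiffAt_invFunOn hD hη hinj hp⟩

end Summit.SmoothPoincare4.SmoothPoincare4.Theorems.GromovRecognitionRelEnd.CrossCapLaurent
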